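import Mathlib
import Summits.NavierStokesRegularity.FluidComputer.AbcClassIIOpenBracket
import Summits.NavierStokesRegularity.FluidComputer.AbcLyapunovInstability

/-!
# Class-II layer of the skew-cut X0 chain, (A3) continued: the open bracket with implementation 2's
# certificate hypotheses VERBATIM, and rung R-α
(instab3 g6 — implementation 1, written against implementation 2's class-II files; cell `ns-blowup`,
2026-08-27)

HONEST FRAMING (human rulings D-0035/D-0074): nothing here is a claim about Navier–Stokes blow-up.
WHAT THIS IS NOT: not NS evidence. MODEL lane; no certificate, printed number or census word is moved.
Sequel of `AbcClassIIOpenBracket`: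

* `shellTest_of_hX` — instab4 g6's shell hypothesis `hX` (shell subtype, full off-head blocks of
  `[(x + |O|²/R)δ − amat]`, true head inverse) ⇒ the shell test on head-vanishing vectors
  (`SkewCutGalerkinFromTranscripts.shellTest_of_shellForm`; the off-head diagonal terms vanish);
* `isLinNSEigenvalue_Ioo_of_certificate` — the hypotheses of
  `AbcClassIISections.isLinNSEigenvalue_of_certificate` VERBATIM ⇒ `λ ∈ (x₁, x₂)` OPEN (strengthening
  its closed bracket);
* `isLyapunovUnstable_of_certificate` — with `0 ≤ x₁`: rung R-α
  (`AbcLyapunovInstability.isLyapunovUnstable_abcFlow_of_eigenvalue`, CONDITIONAL on the named fact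
  FPS06 Thm 2.2): the forced ABC flow is a Lyapunov-unstable steady state of the TRUE forced system.

Mathlib + the files named; no new definitions.
-/

noncomputable section

open scoped BigOperators ComplexConjugate InnerProductSpace Matrix
open Finset MeasureTheory UnitAddTorus Filter Topology Matrix

namespace Summit.NavierStokesRegularity.FluidComputer.AbcClassIIOpenBracket

open Literature.Analysis.FunctionSpaces Literature.Analysis.FunctionSpaces.Torus
open Literature.Analysis.FunctionSpaces.EuclideanSpace
open Literature.Analysis.FluidPDE Literature.Analysis.FluidPDE.SteadyLattice
open Literature.Analysis.FluidPDE.ScalarFourier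
open Summit.NavierStokesRegularity.FluidComputer.AbcClassII

/-- **Shape conversion for implementation 2's shell hypothesis.** instab4's `hX` (the shell form on
the shell subtype with the FULL off-head blocks `[(x + |O|²/R)δ − amat]`, whose diagonal part vanishes
off the head, and the true head inverse) gives the shell test on head-vanishing real vectors used by
`isLinNSEigenvalue_Ioo_of_minimal_transcripts` (`SkewCutGalerkinFromTranscripts.shellTest_of_shellForm`). -/
theorem shellTest_of_hX (R : ℝ) (K : ℕ) (x μ : ℝ)
    (hX : ∀ w : ↥(cubeIdx (K + 1) \ cubeIdx K) → ℝ, μ * (w ⬝ᵥ w) ≤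
      ∑ a : ↥(cubeIdx (K + 1) \ cubeIdx K), (x + onormSq (a : Idx).1 / R) * w a ^ 2 - Real.sqrt 2 * (w ⬝ᵥ w) -
        w ⬝ᵥ (((Matrix.of fun (a : ↥(cubeIdx (K + 1) \ cubeIdx K)) (b : ↥(cubeIdx K)) =>
            (if (a : Idx) = b then x + onormSq (b : Idx).1 / R else 0) - amat a b) *
          (Matrix.of fun a b : ↥(cubeIdx K) =>
            (if (a : Idx) = b then x + onormSq (b : Idx).1 / R else 0) - amat a b)⁻¹ *
          (Matrix.of fun (a : ↥(cubeIdx K)) (b : ↥(cubeIdx (K + 1) \ cubeIdx K)) =>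
            (if (a : Idx) = b then x + onormSq (b : Idx).1 / R else 0) - amat a b)) *ᵥ w)) :
    ∀ v : Idx → ℝ, (∀ i ∈ cubeIdx K, v i = 0) →
      μ * ∑ i ∈ cubeIdx (K + 1) \ cubeIdx K, v i ^ 2 ≤
        ∑ i ∈ cubeIdx (K + 1) \ cubeIdx K, (x + onormSq i.1 / R - Real.sqrt 2) * v i ^ 2 -
        ∑ i ∈ (cubeIdx K).biUnion nbrIdx \ cubeIdx K, (∑ j : ↥(cubeIdx K), amat i j *
          ∑ m : ↥(cubeIdx K), (Matrix.of fun a b : ↥(cubeIdx K) =>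
            (if (a : Idx) = b then x + onormSq (b : Idx).1 / R else 0) - amat a b)⁻¹ j m *
            ∑ l ∈ nbrIdx m \ cubeIdx K, amat m l * v l) * v i := by
  classical
  -- the off-head blocks carry no diagonal term
  have hC : (Matrix.of fun (a : ↥(cubeIdx (K + 1) \ cubeIdx K)) (b : ↥(cubeIdx K)) =>
      (if (a : Idx) = b then x + onormSq (b : Idx).1 / R else 0) - amat a b) =
      Matrix.of fun (a : ↥(cubeIdx (K + 1) \ cubeIdx K)) (b : ↥(cubeIdx K)) => -amat a b := by
    ext a b
    have hab : (a : Idx) ≠ b := fun h => (Finset.mem_sdiff.mp a.2).2 (h ▸ b.2)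
    simp [Matrix.of_apply, hab]
  have hB : (Matrix.of fun (a : ↥(cubeIdx K)) (b : ↥(cubeIdx (K + 1) \ cubeIdx K)) =>
      (if (a : Idx) = b then x + onormSq (b : Idx).1 / R else 0) - amat a b) =
      Matrix.of fun (a : ↥(cubeIdx K)) (b : ↥(cubeIdx (K + 1) \ cubeIdx K)) => -amat a b := by
    ext a b
    have hab : (a : Idx) ≠ b := fun h => (Finset.mem_sdiff.mp b.2).2 (h ▸ a.2)
    simp [Matrix.of_apply, hab]
  have hN : (Matrix.of fun j m : ↥(cubeIdx K) => (Matrix.of fun a b : ↥(cubeIdx K) =>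
      (if (a : Idx) = b then x + onormSq (b : Idx).1 / R else 0) - amat a b)⁻¹ j m) =
      (Matrix.of fun a b : ↥(cubeIdx K) =>
        (if (a : Idx) = b then x + onormSq (b : Idx).1 / R else 0) - amat a b)⁻¹ := by
    ext j m; rfl
  -- locality data
  have hsymm : ∀ i j : Idx, j ∈ nbrIdx i ↔ i ∈ nbrIdx j := mem_nbrIdx_comm
  have har0 : ∀ i j : Idx, j ∉ nbrIdx i → amat i j = 0 := fun i j h => amat_eq_zero_of_not_mem h
  have hloc : ∀ i ∈ cubeIdx K, nbrIdx i ⊆ cubeIdx (K + 1) := by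
    intro i hi j hj
    have h1 := (osupNorm_le_of_mem_nbrIdx hj).2
    have h2 := mem_cubeIdx.mp hi
    exact mem_cubeIdx.mpr (by omega)
  -- instab4's shell form in the generic subtype shape
  have hX' : ∀ w : ↥(cubeIdx (K + 1) \ cubeIdx K) → ℝ, μ * ∑ i, w i ^ 2 ≤
      ∑ i : ↥(cubeIdx (K + 1) \ cubeIdx K), (x - (-(onormSq i.1.1 / R)) - Real.sqrt 2) * w i ^ 2 -
      w ⬝ᵥ (((Matrix.of fun (i : ↥(cubeIdx (K + 1) \ cubeIdx K)) (j : ↥(cubeIdx K)) => -amat i j) *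
        (Matrix.of fun j m : ↥(cubeIdx K) => (Matrix.of fun a b : ↥(cubeIdx K) =>
          (if (a : Idx) = b then x + onormSq (b : Idx).1 / R else 0) - amat a b)⁻¹ j m) *
        (Matrix.of fun (i : ↥(cubeIdx K)) (j : ↥(cubeIdx (K + 1) \ cubeIdx K)) => -amat i j)) *ᵥ w) := by
    intro w
    have h := hX w
    rw [hC, hB] at h
    rw [hN]
    have hww : w ⬝ᵥ w = ∑ i, w i ^ 2 := by
      rw [dotProduct]; exact Finset.sum_congr rfl fun i _ => by ring
    have hsplit : ∑ i : ↥(cubeIdx (K + 1) \ cubeIdx K), (x - (-(onormSq i.1.1 / R)) - Real.sqrt 2) * w i ^ 2 =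
        ∑ a : ↥(cubeIdx (K + 1) \ cubeIdx K), (x + onormSq (a : Idx).1 / R) * w a ^ 2 -
          Real.sqrt 2 * ∑ i, w i ^ 2 := by
      rw [Finset.mul_sum, ← Finset.sum_sub_distrib]
      exact Finset.sum_congr rfl fun i _ => by ring
    rw [hsplit, ← hww]
    exact h
  have key := SkewCutGalerkinFromTranscripts.shellTest_of_shellForm (fun i : Idx => -(onormSq i.1 / R)) amat
    nbrIdx hsymm har0 (cubeIdx K) (cubeIdx (K + 1)) hloc x (Real.sqrt 2) μ _ hX'
  intro v hv
  have h := key v hv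
  simp only [sub_neg_eq_add] at h
  exact h

/-- **(A3) THE OPEN BRACKET with implementation 2's hypotheses VERBATIM**: the hypotheses of instab4 g6's
`AbcClassIISections.isLinNSEigenvalue_of_certificate` — head signs (T1), shell forms (T2) on the shell
subtype with the true head inverse, tail numbers (T3) — give `∃ λ ∈ (x₁, x₂)` (OPEN, strengthening its
`λ ∈ [x₁, x₂]`), `Torus.IsLinNSEigenvalue (1/(2πR)) (Torus.abcFlow 1 1 1) (2πλ)`. -/
theorem isLinNSEigenvalue_Ioo_of_certificate {R : ℝ} (hR : 1 ≤ R) (K : ℕ) {x₁ x₂ : ℝ} (hlt : x₁ < x₂)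
    (μ₁ μ₂ : ℝ) (hμ₁ : 0 < μ₁) (hμ₂ : 0 < μ₂)
    (hq₁ : μ₁ ≤ x₁ + ((K : ℝ) + 2) ^ 2 / R - Real.sqrt 2) (hq₂ : μ₂ ≤ x₂ + ((K : ℝ) + 2) ^ 2 / R - Real.sqrt 2)
    (hdet : (Matrix.of fun a b : ↥(cubeIdx K) =>
        (if (a : Idx) = b then x₁ + onormSq (b : Idx).1 / R else 0) - amat a b).det *
      (Matrix.of fun a b : ↥(cubeIdx K) =>
        (if (a : Idx) = b then x₂ + onormSq (b : Idx).1 / R else 0) - amat a b).det < 0)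
    (hX₁ : ∀ w : ↥(cubeIdx (K + 1) \ cubeIdx K) → ℝ, μ₁ * (w ⬝ᵥ w) ≤
      ∑ a : ↥(cubeIdx (K + 1) \ cubeIdx K), (x₁ + onormSq (a : Idx).1 / R) * w a ^ 2 - Real.sqrt 2 * (w ⬝ᵥ w) -
        w ⬝ᵥ (((Matrix.of fun (a : ↥(cubeIdx (K + 1) \ cubeIdx K)) (b : ↥(cubeIdx K)) =>
            (if (a : Idx) = b then x₁ + onormSq (b : Idx).1 / R else 0) - amat a b) *
          (Matrix.of fun a b : ↥(cubeIdx K) =>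
            (if (a : Idx) = b then x₁ + onormSq (b : Idx).1 / R else 0) - amat a b)⁻¹ *
          (Matrix.of fun (a : ↥(cubeIdx K)) (b : ↥(cubeIdx (K + 1) \ cubeIdx K)) =>
            (if (a : Idx) = b then x₁ + onormSq (b : Idx).1 / R else 0) - amat a b)) *ᵥ w))
    (hX₂ : ∀ w : ↥(cubeIdx (K + 1) \ cubeIdx K) → ℝ, μ₂ * (w ⬝ᵥ w) ≤
      ∑ a : ↥(cubeIdx (K + 1) \ cubeIdx K), (x₂ + onormSq (a : Idx).1 / R) * w a ^ 2 - Real.sqrt 2 * (w ⬝ᵥ w) -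
        w ⬝ᵥ (((Matrix.of fun (a : ↥(cubeIdx (K + 1) \ cubeIdx K)) (b : ↥(cubeIdx K)) =>
            (if (a : Idx) = b then x₂ + onormSq (b : Idx).1 / R else 0) - amat a b) *
          (Matrix.of fun a b : ↥(cubeIdx K) =>
            (if (a : Idx) = b then x₂ + onormSq (b : Idx).1 / R else 0) - amat a b)⁻¹ *
          (Matrix.of fun (a : ↥(cubeIdx K)) (b : ↥(cubeIdx (K + 1) \ cubeIdx K)) =>
            (if (a : Idx) = b then x₂ + onormSq (b : Idx).1 / R else 0) - amat a b)) *ᵥ w)) :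
    ∃ lam ∈ Set.Ioo x₁ x₂,
      Torus.IsLinNSEigenvalue (1 / (2 * Real.pi * R)) (Torus.abcFlow 1 1 1) ((2 * Real.pi * lam : ℝ) : ℂ) :=
  isLinNSEigenvalue_Ioo_of_minimal_transcripts hR K hlt μ₁ μ₂ hμ₁ hμ₂ hq₁ hq₂ hdet
    (shellTest_of_hX R K x₁ μ₁ hX₁) (shellTest_of_hX R K x₂ μ₂ hX₂)

/-- **Rung R-α from the certificate** (CONDITIONAL on the named fact
`Torus.fps2006_nonlinear_instability_of_eigenvalue`, Friedlander–Pavlović–Shvydkoy 2006 Thm 2.2): under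
the hypotheses of `isLinNSEigenvalue_Ioo_of_certificate` and `0 ≤ x₁`, the certified class-II
eigenvalue `2πλ > 0` makes the forced ABC flow (`A = B = C = 1`, viscosity `1/(2πR)` on the unit torus,
force `4π²ν·U`) a Lyapunov-unstable steady state of the TRUE forced Navier–Stokes dynamics — an
INSTABILITY statement, not blow-up, not (A)/(C)/(D). -/
theorem isLyapunovUnstable_of_certificate
    (hFPS : Torus.fps2006_nonlinear_instability_of_eigenvalue)
    {R : ℝ} (hR : 1 ≤ R) (K : ℕ) {x₁ x₂ : ℝ} (hx₁ : 0 ≤ x₁) (hlt : x₁ < x₂)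
    (μ₁ μ₂ : ℝ) (hμ₁ : 0 < μ₁) (hμ₂ : 0 < μ₂)
    (hq₁ : μ₁ ≤ x₁ + ((K : ℝ) + 2) ^ 2 / R - Real.sqrt 2) (hq₂ : μ₂ ≤ x₂ + ((K : ℝ) + 2) ^ 2 / R - Real.sqrt 2)
    (hdet : (Matrix.of fun a b : ↥(cubeIdx K) =>
        (if (a : Idx) = b then x₁ + onormSq (b : Idx).1 / R else 0) - amat a b).det *
      (Matrix.of fun a b : ↥(cubeIdx K) =>
        (if (a : Idx) = b then x₂ + onormSq (b : Idx).1 / R else 0) - amat a b).det < 0)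
    (hX₁ : ∀ w : ↥(cubeIdx (K + 1) \ cubeIdx K) → ℝ, μ₁ * (w ⬝ᵥ w) ≤
      ∑ a : ↥(cubeIdx (K + 1) \ cubeIdx K), (x₁ + onormSq (a : Idx).1 / R) * w a ^ 2 - Real.sqrt 2 * (w ⬝ᵥ w) -
        w ⬝ᵥ (((Matrix.of fun (a : ↥(cubeIdx (K + 1) \ cubeIdx K)) (b : ↥(cubeIdx K)) =>
            (if (a : Idx) = b then x₁ + onormSq (b : Idx).1 / R else 0) - amat a b) *
          (Matrix.of fun a b : ↥(cubeIdx K) =>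
            (if (a : Idx) = b then x₁ + onormSq (b : Idx).1 / R else 0) - amat a b)⁻¹ *
          (Matrix.of fun (a : ↥(cubeIdx K)) (b : ↥(cubeIdx (K + 1) \ cubeIdx K)) =>
            (if (a : Idx) = b then x₁ + onormSq (b : Idx).1 / R else 0) - amat a b)) *ᵥ w))
    (hX₂ : ∀ w : ↥(cubeIdx (K + 1) \ cubeIdx K) → ℝ, μ₂ * (w ⬝ᵥ w) ≤
      ∑ a : ↥(cubeIdx (K + 1) \ cubeIdx K), (x₂ + onormSq (a : Idx).1 / R) * w a ^ 2 - Real.sqrt 2 * (w ⬝ᵥ w) -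
        w ⬝ᵥ (((Matrix.of fun (a : ↥(cubeIdx (K + 1) \ cubeIdx K)) (b : ↥(cubeIdx K)) =>
            (if (a : Idx) = b then x₂ + onormSq (b : Idx).1 / R else 0) - amat a b) *
          (Matrix.of fun a b : ↥(cubeIdx K) =>
            (if (a : Idx) = b then x₂ + onormSq (b : Idx).1 / R else 0) - amat a b)⁻¹ *
          (Matrix.of fun (a : ↥(cubeIdx K)) (b : ↥(cubeIdx (K + 1) \ cubeIdx K)) =>
            (if (a : Idx) = b then x₂ + onormSq (b : Idx).1 / R else 0) - amat a b)) *ᵥ w)) :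
    Torus.IsLyapunovUnstableSteadyState (1 / (2 * Real.pi * R))
      (fun x => (4 * Real.pi ^ 2 * (1 / (2 * Real.pi * R))) • Torus.abcFlow 1 1 1 x) (Torus.abcFlow 1 1 1) := by
  obtain ⟨lam, hlam, heig⟩ := isLinNSEigenvalue_Ioo_of_certificate hR K hlt μ₁ μ₂ hμ₁ hμ₂ hq₁ hq₂ hdet hX₁ hX₂
  have hR0 : 0 < R := by linarith
  have hν : 0 < 1 / (2 * Real.pi * R) := by positivity
  have hlam0 : 0 < lam := lt_of_le_of_lt hx₁ hlam.1
  have hre : 0 < (((2 * Real.pi * lam : ℝ) : ℂ)).re := by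
    rw [Complex.ofReal_re]; positivity
  exact AbcLyapunovInstability.isLyapunovUnstable_abcFlow_of_eigenvalue hFPS hν 1 1 1 hre heig

end Summit.NavierStokesRegularity.FluidComputer.AbcClassIIOpenBracket

end
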